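import Literature.NumberTheory.EllipticCurves.CuspFunctionDerivativeProofs
import Literature.NumberTheory.EllipticCurves.CuspFormAutConjProofs
import Literature.NumberTheory.EllipticCurves.EichlerShimuraPeriodsGamma1
import HarnessLib

/-!
# Transport of the differential equation of `℘_Λ(2πi∫f) = F/G` along `Aut(ℂ)`

Topic `NumberTheory/EllipticCurves`; a proofs-only file (theorems only, no definitions, no named
facts). Let `f ∈ S₂(Γ₀(N))` have rational Fourier coefficients and let `F, G ∈ S_k(Γ₁(N))`.
Write `θ = (2πi)⁻¹ d/dz = q d/dq`, which acts on `q`-expansions by `Σ aₙqⁿ ↦ Σ n aₙqⁿ` (the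
tree's `IsCuspFunction.qExpansion_coeff_deriv`, `CuspFunctionDerivativeProofs.lean`). The
function identity

  `(G·θF − F·θG)² = f²·G·(4F³ − A·FG² − B·G³)`    (†)

(which for `F/G = ℘_Λ(2πi∫f)` and `(A, B) = (g₂, g₃)(Λ)` is the differential equation
`(θx)² = f²(4x³ − g₂x − g₃)` of the analytic modular parametrisation, cleared of denominators)
is equivalent to the same identity between `q`-expansions in `ℂ⟦q⟧`
(`odeFun_apply_eq_zero_iff`, by the `q`-expansion principle for cuspidal `q`-series functions),
and the latter identity is a polynomial identity in the coefficients of `F, G, f` and `A, B`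
with **rational** structure constants (`θ` has the rational symbol `n`). Hence it is transported
by every field automorphism `σ` of `ℂ` (`map_odePS`): if `F', G'` have coefficients
`σ(aₙ(F)), σ(aₙ(G))` (the conjugate forms of `CuspFormAutConjProofs.lean`, Deligne–Serre 1974,
(2.7.4)) and `f` has rational coefficients, then (†) for `(F, G; A, B)` implies (†) for
`(F', G'; σA, σB)` — `odeFun_conj_apply_eq_zero`. This is the modular-form half of the descent
argument for the period lattice of `f` (Shimura 1971, §6–§7, descent of the field of definition
by the action of `Aut(ℂ)` on `q`-expansions; here in the elementary form "`σ` acts on the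
differential equation").

## Main statements

* `map_thetaPS`, `map_odePS` — `σ` commutes with `q d/dq` and with the expression (†) on `ℂ⟦q⟧`;
* `qExpansion_map_eq_self_of_rat` — a form with rational coefficients has `σ`-invariant
  `q`-expansion (that the `q`-expansion of a conjugate form `F'`, `aₙ(F') = σ(aₙ(F))`, is `σ` of
  the `q`-expansion of `F` is `PowerSeries.ext` coefficientwise, used inline);
* `qExpansion_odeFun` — the `q`-expansion of the function
  `(G·F′ − F·G′)² − (2πi)²f²G(4F³ − AFG² − BG³)` (`′ = d/dz`) is `(2πi)²` times (†) on
  `q`-expansions;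
* `odeFun_apply_eq_zero_iff`, `odeFun_conj_apply_eq_zero` — the equivalence and the transport.

## References

* P. Deligne, J.-P. Serre, *Formes modulaires de poids 1*, Ann. Sci. ÉNS 7 (1974): (2.7.4).
  [DeligneSerreASENS1974]
* G. Shimura, *Introduction to the arithmetic theory of automorphic functions*, 1971: §3.5, §6.
  [ShimuraIATAF1971]
* F. Diamond, J. Shurman, *A First Course in Modular Forms*, GTM 228: §1.1 (`q`-expansions).
  [DiamondShurman2005]
-/

noncomputable section

open Complex Filter Topology Set Function PowerSeries
open UpperHalfPlane hiding I
open scoped Real Topology Manifold MatrixGroups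

namespace Literature.NumberTheory.EllipticCurves.ModularForms

open CongruenceSubgroup

/-! ### Power-series algebra: `q d/dq` and the expression (†) commute with `σ` -/

/-- `σ` commutes with `q d/dq` on `ℂ⟦q⟧`: `σ(Σ n aₙ qⁿ) = Σ n σ(aₙ) qⁿ`. [folklore] -/
theorem map_thetaPS (σ : ℂ →+* ℂ) (a : ℂ⟦X⟧) :
    (PowerSeries.mk fun n ↦ (n : ℂ) * coeff n a).map σ =
      PowerSeries.mk fun n ↦ (n : ℂ) * coeff n (a.map σ) := by
  ext n
  simp [coeff_map]

/-- `σ` commutes with the expression `(b·θa − a·θb)² − e²b(4a³ − A ab² − B b³)` on `ℂ⟦q⟧`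
(`θ = q d/dq`), `A, B` being replaced by `σA, σB`. [folklore] -/
theorem map_odePS (σ : ℂ →+* ℂ) (a b e : ℂ⟦X⟧) (A B : ℂ) :
    ((b * PowerSeries.mk (fun n ↦ (n : ℂ) * coeff n a) -
        a * PowerSeries.mk (fun n ↦ (n : ℂ) * coeff n b)) ^ 2 -
      e ^ 2 * b * (4 * a ^ 3 - PowerSeries.C A * a * b ^ 2 - PowerSeries.C B * b ^ 3)).map σ =
    ((b.map σ * PowerSeries.mk (fun n ↦ (n : ℂ) * coeff n (a.map σ)) -
        a.map σ * PowerSeries.mk (fun n ↦ (n : ℂ) * coeff n (b.map σ))) ^ 2 -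
      (e.map σ) ^ 2 * b.map σ * (4 * a.map σ ^ 3 - PowerSeries.C (σ A) * a.map σ * b.map σ ^ 2 -
        PowerSeries.C (σ B) * b.map σ ^ 3)) := by
  simp only [map_sub, map_mul, map_pow, map_thetaPS, PowerSeries.map_C, map_ofNat]

/-! ### `q`-expansions of forms with rational coefficients -/

variable {N : ℕ} [NeZero N] {k : ℤ}

omit [NeZero N] in
/-- A cusp form with rational Fourier coefficients has `σ`-invariant `q`-expansion. [folklore] -/
theorem qExpansion_map_eq_self_of_rat {σ : ℂ ≃+* ℂ} (f : CuspForm (Gamma0 N) 2)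
    (hrat : ∀ n, ∃ q : ℚ, (q : ℂ) = cuspCoeff f n) :
    (qExpansion 1 ⇑f).map (σ : ℂ →+* ℂ) = qExpansion 1 ⇑f := by
  ext n
  obtain ⟨q, hq⟩ := hrat n
  rw [coeff_map]
  change σ (cuspCoeff f n) = cuspCoeff f n
  rw [← hq]
  exact map_ratCast σ q

/-! ### The `q`-expansion of the differential expression -/

/-- The `q`-expansion of `τ ↦ d/dz F(τ)` is `2πi · θ(qexp F)` with `θ = q d/dq`. [folklore] -/
theorem qExpansion_deriv_eq {φ : ℍ → ℂ} (hφ : IsCuspFunction 1 φ) :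
    qExpansion 1 (fun τ : ℍ ↦ deriv (φ ∘ ofComplex) τ) =
      PowerSeries.C (2 * π * I) * PowerSeries.mk fun n ↦ (n : ℂ) * coeff n (qExpansion 1 φ) := by
  ext n
  rw [hφ.qExpansion_coeff_deriv n, PowerSeries.coeff_C_mul, coeff_mk]
  push_cast
  ring

/-! ### Tracking `q`-expansions through ring operations and `d/dz` -/

section Track

variable {φ ψ : ℍ → ℂ} {a b : ℂ⟦X⟧}

/-- Product rule for tracked `q`-expansions of cusp functions. [folklore] -/
theorem qexp_track_mul (hφ : IsCuspFunction 1 φ) (ha : qExpansion 1 φ = a)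
    (hψ : IsCuspFunction 1 ψ) (hb : qExpansion 1 ψ = b) :
    IsCuspFunction 1 (φ * ψ) ∧ qExpansion 1 (φ * ψ) = a * b :=
  ⟨hφ.mul hψ, by rw [qExpansion_mul hφ.analyticAt_cuspFunction_zero hψ.analyticAt_cuspFunction_zero,
    ha, hb]⟩

/-- Difference rule for tracked `q`-expansions of cusp functions. [folklore] -/
theorem qexp_track_sub (hφ : IsCuspFunction 1 φ) (ha : qExpansion 1 φ = a)
    (hψ : IsCuspFunction 1 ψ) (hb : qExpansion 1 ψ = b) :
    IsCuspFunction 1 (φ - ψ) ∧ qExpansion 1 (φ - ψ) = a - b :=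
  ⟨hφ.sub hψ, by rw [qExpansion_sub hφ.analyticAt_cuspFunction_zero hψ.analyticAt_cuspFunction_zero,
    ha, hb]⟩

/-- Scalar rule for tracked `q`-expansions of cusp functions. [folklore] -/
theorem qexp_track_smul (hφ : IsCuspFunction 1 φ) (ha : qExpansion 1 φ = a) (c : ℂ) :
    IsCuspFunction 1 (c • φ) ∧ qExpansion 1 (c • φ) = PowerSeries.C c * a :=
  ⟨hφ.const_smul c, by rw [qExpansion_smul hφ.analyticAt_cuspFunction_zero, ha,
    PowerSeries.smul_eq_C_mul]⟩

/-- Derivative rule for tracked `q`-expansions: `qexp(dφ/dz) = 2πi · θ(qexp φ)`, `θ = q d/dq`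
(`IsCuspFunction.qExpansion_coeff_deriv`). [folklore] -/
theorem qexp_track_deriv (hφ : IsCuspFunction 1 φ) (ha : qExpansion 1 φ = a) :
    IsCuspFunction 1 (fun τ : ℍ ↦ deriv (φ ∘ ofComplex) τ) ∧
      qExpansion 1 (fun τ : ℍ ↦ deriv (φ ∘ ofComplex) τ) =
        PowerSeries.C (2 * π * I) * PowerSeries.mk fun n ↦ (n : ℂ) * coeff n a := by
  refine ⟨hφ.deriv, ?_⟩
  ext n
  rw [hφ.qExpansion_coeff_deriv n, PowerSeries.coeff_C_mul, coeff_mk, ← ha]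
  push_cast
  ring

end Track

/-! ### The differential expression and its `q`-expansion -/

section ODEFun

variable (f : CuspForm (Gamma0 N) 2) (F G : CuspForm (Gamma1 N) k) (A B : ℂ)

/-- **The `q`-expansion of the differential expression.** For `F, G ∈ S_k(Γ₁(N))`,
`f ∈ S₂(Γ₀(N))`, constants `A, B`, and `′ = d/dz`, the function
`Φ = (G·F′ − F·G′)(G·F′ − F·G′) − (2πi)² • (f·f·G·(4•(F·F·F) − A•(F·G·G) − B•(G·G·G)))`
is a cuspidal `q`-series function of period `1`, and its `q`-expansion is `(2πi)²` times
`(bθa − aθb)² − e²b(4a³ − A ab² − B b³)` where `a, b, e` are the `q`-expansions of `F, G, f`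
and `θ = q d/dq` (`qexp(F′) = 2πi θa`, multiplicativity of `q`-expansions). [folklore] -/
theorem isCuspFunction_and_qExpansion_odeFun :
    IsCuspFunction 1
      ((⇑G * (fun τ : ℍ ↦ deriv (⇑F ∘ ofComplex) τ) - ⇑F * (fun τ : ℍ ↦ deriv (⇑G ∘ ofComplex) τ)) *
        (⇑G * (fun τ : ℍ ↦ deriv (⇑F ∘ ofComplex) τ) - ⇑F * (fun τ : ℍ ↦ deriv (⇑G ∘ ofComplex) τ)) -
      ((2 * π * I) ^ 2 : ℂ) • (⇑f * ⇑f * ⇑G *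
        ((4 : ℂ) • (⇑F * ⇑F * ⇑F) - A • (⇑F * ⇑G * ⇑G) - B • (⇑G * ⇑G * ⇑G)))) ∧
    qExpansion 1
      ((⇑G * (fun τ : ℍ ↦ deriv (⇑F ∘ ofComplex) τ) - ⇑F * (fun τ : ℍ ↦ deriv (⇑G ∘ ofComplex) τ)) *
        (⇑G * (fun τ : ℍ ↦ deriv (⇑F ∘ ofComplex) τ) - ⇑F * (fun τ : ℍ ↦ deriv (⇑G ∘ ofComplex) τ)) -
      ((2 * π * I) ^ 2 : ℂ) • (⇑f * ⇑f * ⇑G *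
        ((4 : ℂ) • (⇑F * ⇑F * ⇑F) - A • (⇑F * ⇑G * ⇑G) - B • (⇑G * ⇑G * ⇑G)))) =
    PowerSeries.C ((2 * π * I) ^ 2) *
      ((qExpansion 1 ⇑G * PowerSeries.mk (fun n ↦ (n : ℂ) * coeff n (qExpansion 1 ⇑F)) -
          qExpansion 1 ⇑F * PowerSeries.mk (fun n ↦ (n : ℂ) * coeff n (qExpansion 1 ⇑G))) ^ 2 -
        qExpansion 1 ⇑f ^ 2 * qExpansion 1 ⇑G *
          (4 * qExpansion 1 ⇑F ^ 3 - PowerSeries.C A * qExpansion 1 ⇑F * qExpansion 1 ⇑G ^ 2 -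
            PowerSeries.C B * qExpansion 1 ⇑G ^ 3)) := by
  have hF : IsCuspFunction 1 ⇑F := isCuspFunction_one_gamma1 F
  have hG : IsCuspFunction 1 ⇑G := isCuspFunction_one_gamma1 G
  have hf : IsCuspFunction 1 ⇑f := isCuspFunction_one f
  set a := qExpansion 1 ⇑F with ha
  set b := qExpansion 1 ⇑G with hb
  set e := qExpansion 1 ⇑f with he
  obtain ⟨hdF, edF⟩ := qexp_track_deriv hF ha.symm
  obtain ⟨hdG, edG⟩ := qexp_track_deriv hG hb.symm
  obtain ⟨h1, e1⟩ := qexp_track_mul hG hb.symm hdF edF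
  obtain ⟨h2, e2⟩ := qexp_track_mul hF ha.symm hdG edG
  obtain ⟨hW, eW⟩ := qexp_track_sub h1 e1 h2 e2
  obtain ⟨hW2, eW2⟩ := qexp_track_mul hW eW hW eW
  obtain ⟨hFF, eFF⟩ := qexp_track_mul hF ha.symm hF ha.symm
  obtain ⟨hFFF, eFFF⟩ := qexp_track_mul hFF eFF hF ha.symm
  obtain ⟨hFG, eFG⟩ := qexp_track_mul hF ha.symm hG hb.symm
  obtain ⟨hFGG, eFGG⟩ := qexp_track_mul hFG eFG hG hb.symm
  obtain ⟨hGG, eGG⟩ := qexp_track_mul hG hb.symm hG hb.symm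
  obtain ⟨hGGG, eGGG⟩ := qexp_track_mul hGG eGG hG hb.symm
  obtain ⟨h4, e4⟩ := qexp_track_smul hFFF eFFF (4 : ℂ)
  obtain ⟨hA, eA⟩ := qexp_track_smul hFGG eFGG A
  obtain ⟨hB, eB⟩ := qexp_track_smul hGGG eGGG B
  obtain ⟨hP1, eP1⟩ := qexp_track_sub h4 e4 hA eA
  obtain ⟨hP, eP⟩ := qexp_track_sub hP1 eP1 hB eB
  obtain ⟨hff, eff⟩ := qexp_track_mul hf he.symm hf he.symm
  obtain ⟨hffG, effG⟩ := qexp_track_mul hff eff hG hb.symm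
  obtain ⟨hR, eR⟩ := qexp_track_mul hffG effG hP eP
  obtain ⟨hRc, eRc⟩ := qexp_track_smul hR eR ((2 * π * I) ^ 2 : ℂ)
  obtain ⟨hΦ, eΦ⟩ := qexp_track_sub hW2 eW2 hRc eRc
  refine ⟨hΦ, ?_⟩
  rw [eΦ]
  simp only [map_pow, map_ofNat]
  ring

/-- **The function identity is equivalent to the `q`-expansion identity** (†):
`(G·F′ − F·G′)² = (2πi)² f²G(4F³ − AFG² − BG³)` on `ℍ` iff
`(bθa − aθb)² = e²b(4a³ − Aab² − Bb³)` in `ℂ⟦q⟧` — the `q`-expansion principle for the cuspidal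
`q`-series function `Φ` (Mathlib `qExpansion_eq_zero_iff`) and `(2πi)² ≠ 0`. [folklore] -/
theorem odeFun_eq_zero_iff :
    (⇑G * (fun τ : ℍ ↦ deriv (⇑F ∘ ofComplex) τ) - ⇑F * (fun τ : ℍ ↦ deriv (⇑G ∘ ofComplex) τ)) *
        (⇑G * (fun τ : ℍ ↦ deriv (⇑F ∘ ofComplex) τ) - ⇑F * (fun τ : ℍ ↦ deriv (⇑G ∘ ofComplex) τ)) -
      ((2 * π * I) ^ 2 : ℂ) • (⇑f * ⇑f * ⇑G *
        ((4 : ℂ) • (⇑F * ⇑F * ⇑F) - A • (⇑F * ⇑G * ⇑G) - B • (⇑G * ⇑G * ⇑G))) = 0 ↔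
    (qExpansion 1 ⇑G * PowerSeries.mk (fun n ↦ (n : ℂ) * coeff n (qExpansion 1 ⇑F)) -
          qExpansion 1 ⇑F * PowerSeries.mk (fun n ↦ (n : ℂ) * coeff n (qExpansion 1 ⇑G))) ^ 2 -
        qExpansion 1 ⇑f ^ 2 * qExpansion 1 ⇑G *
          (4 * qExpansion 1 ⇑F ^ 3 - PowerSeries.C A * qExpansion 1 ⇑F * qExpansion 1 ⇑G ^ 2 -
            PowerSeries.C B * qExpansion 1 ⇑G ^ 3) = 0 := by
  obtain ⟨hΦ, eΦ⟩ := isCuspFunction_and_qExpansion_odeFun f F G A B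
  have key := qExpansion_eq_zero_iff hΦ.pos hΦ.periodic hΦ.mdifferentiable hΦ.isBoundedAtImInfty
  rw [← key, eΦ]
  have hc0 : ((2 * π * I) ^ 2 : ℂ) ≠ 0 :=
    pow_ne_zero 2 (mul_ne_zero (mul_ne_zero two_ne_zero (ofReal_ne_zero.mpr Real.pi_ne_zero))
      I_ne_zero)
  have hc : PowerSeries.C ((2 * π * I) ^ 2 : ℂ) ≠ 0 := by
    intro h0
    have := congrArg (PowerSeries.coeff 0) h0
    simp [hc0] at this
  constructor
  · intro h
    exact (mul_eq_zero.mp h).resolve_left hc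
  · intro h
    rw [h, mul_zero]

end ODEFun

/-! ### Transport along `σ ∈ Aut(ℂ)` -/

/-- **`σ` transports the differential identity.** Let `f ∈ S₂(Γ₀(N))` have rational
coefficients, `F, G, F', G' ∈ S_k(Γ₁(N))` with `aₙ(F') = σ(aₙ(F))`, `aₙ(G') = σ(aₙ(G))` for a
field automorphism `σ` of `ℂ`. If `(G·F′ − F·G′)² = (2πi)² f²G(4F³ − AFG² − BG³)` on `ℍ`, then
`(G'·F'′ − F'·G'′)² = (2πi)² f²G'(4F'³ − σ(A)F'G'² − σ(B)G'³)` on `ℍ`: pass to `q`-expansions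
(`odeFun_eq_zero_iff`), apply `σ` coefficientwise (`map_odePS`; `σ` fixes the expansion of `f`
and maps those of `F, G` to those of `F', G'`), and come back.
[cite: DeligneSerreASENS1974, Prop. 2.7 (2.7.4)] -/
theorem odeFun_conj_eq_zero (f : CuspForm (Gamma0 N) 2)
    (hrat : ∀ n, ∃ q : ℚ, (q : ℂ) = cuspCoeff f n) (σ : ℂ ≃+* ℂ)
    {F G F' G' : CuspForm (Gamma1 N) k} (hF : ∀ n, cuspCoeff F' n = σ (cuspCoeff F n))
    (hG : ∀ n, cuspCoeff G' n = σ (cuspCoeff G n)) (A B : ℂ)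
    (h : (⇑G * (fun τ : ℍ ↦ deriv (⇑F ∘ ofComplex) τ) - ⇑F * (fun τ : ℍ ↦ deriv (⇑G ∘ ofComplex) τ)) *
        (⇑G * (fun τ : ℍ ↦ deriv (⇑F ∘ ofComplex) τ) - ⇑F * (fun τ : ℍ ↦ deriv (⇑G ∘ ofComplex) τ)) -
      ((2 * π * I) ^ 2 : ℂ) • (⇑f * ⇑f * ⇑G *
        ((4 : ℂ) • (⇑F * ⇑F * ⇑F) - A • (⇑F * ⇑G * ⇑G) - B • (⇑G * ⇑G * ⇑G))) = 0) :
    (⇑G' * (fun τ : ℍ ↦ deriv (⇑F' ∘ ofComplex) τ) - ⇑F' * (fun τ : ℍ ↦ deriv (⇑G' ∘ ofComplex) τ)) *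
        (⇑G' * (fun τ : ℍ ↦ deriv (⇑F' ∘ ofComplex) τ) - ⇑F' * (fun τ : ℍ ↦ deriv (⇑G' ∘ ofComplex) τ)) -
      ((2 * π * I) ^ 2 : ℂ) • (⇑f * ⇑f * ⇑G' *
        ((4 : ℂ) • (⇑F' * ⇑F' * ⇑F') - σ A • (⇑F' * ⇑G' * ⇑G') - σ B • (⇑G' * ⇑G' * ⇑G'))) = 0 := by
  rw [odeFun_eq_zero_iff] at h ⊢
  have hmap := congrArg (PowerSeries.map (σ : ℂ →+* ℂ)) h
  rw [map_zero, map_odePS] at hmap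
  -- the `q`-expansion of a conjugate form is `σ` of the `q`-expansion: `PowerSeries.ext`
  -- coefficientwise (`cuspCoeff F n = coeff n (qExpansion 1 ⇑F)` and `coeff_map` hold by `rfl`)
  rw [(PowerSeries.ext hF : qExpansion 1 ⇑F' = (qExpansion 1 ⇑F).map (σ : ℂ →+* ℂ)),
    (PowerSeries.ext hG : qExpansion 1 ⇑G' = (qExpansion 1 ⇑G).map (σ : ℂ →+* ℂ)),
    ← qExpansion_map_eq_self_of_rat f hrat (σ := σ)]
  simpa using hmap

end Literature.NumberTheory.EllipticCurves.ModularForms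

end
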